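import Literature.Analysis.FluidPDE.CLVelocityEstimates
import HarnessLib

/-!
# Cheskidov–Luo convex integration: the energy estimate of the principal part (CL22 Prop. 5.3)

Analysis/FluidPDE support file (all results proved) for the proof of Prop. 4.1 of A. Cheskidov,
X. Luo, *Sharp nonuniqueness for the Navier–Stokes equations*, Invent. Math. 229 (2022) =
arXiv:2009.06596, §5.2, Prop. 5.3, `L²_{t,x}` part (numbering of the held arXiv copy):
"`‖w^{(p)}‖_{L²([0,1] × 𝕋^d)} ≲ ‖R̄‖^{1/2}_{L¹([0,1] × 𝕋^d)} + C_u σ^{-1/2}`", for the explicit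
principal part `D.wp = ∑_x G_x ã_x ψ_x(σ·) k_x` of `CLPerturbation` (data `D : CL22.Datum d`), with
the constants `A` (`D.DataBounds A`, "`C_u`") and `C` (`D.BlockConsts C`) of `CLDataBounds`.
The printed proof ("taking `L²` norm in space and appealing to Lemma 7.1 [improved Hölder] …
notice that `t ↦ ∫ρ` is a smooth map on `[0,1]`, thus we may apply Lemma 7.1 once again (with
`p = 1`) to obtain (5.8)") is followed, in the variant of this series:

* `norm_wp_sq` — at each `(t, y)` only one direction is active (`G_xG_{x'} = 0`), so
  `‖w^{(p)}‖² = ∑_x G_x² ã_x² ψ_x(σ·)² |k_x|²` EXACTLY (no far-field interactions);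
* `integral_norm_wp_sq_le` — space: `∫ ã_x²ψ_x(σ·)² = ∫ ã_x² + ∫ ã_x² (ψ_x²-1)(σ·)` (`∫ψ_x² = 1`) and
  the Green pairing `|∫ b F(σ·)| ≤ σ⁻² sup|Δb| ‖Δ⁻¹F‖₂` (`MikadoRescaled`, the `p = 2` substitute for
  Lemma 7.1): `∫‖w^{(p)}(t)‖² ≤ ∑_x G_x(t)²|k_x|² (∫ã_x(t)² + σ⁻²ACμ^a)`;
* `intervalIntegral_G_sq_mul_le` — time, (5.8): `∫₀ᵀ G_x² F ≤ ∫₀ᵀ F + ν⁻¹(|F(0)| + |F(T)| + ∫₀ᵀ|F'|)`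
  (integration by parts against `g_κ²(νt) - 1`, `IntermittentTimeProfiles`) with
  `F(t) = ∫ã_x(t)²`, `|F| ≤ A²`, `|F'| ≤ A`;
* `sum_dirNormSq_mul_atil_sq_le` — the trace identity of Lemma 4.4:
  `∑_x |k_x|² ã_x² = θ²(dρ - tr R) ≤ c₁‖R‖ + c₂γ₀` with `ρ ≤ (2/r_d)(d‖R‖ + γ₀)` (`CLAmplitudes`),
  `c₁ = 2d²/r_d + d`, `c₂ = 2d/r_d` — here the floor `γ₀` of the divisor shows up, which is why
  Prop. 4.1 is rendered with `‖w‖₂ ≲ ‖R̄‖₁^{1/2}` only after choosing `γ₀ ≲ ‖R̄‖₁`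
  (docstring of `Torus.CheskidovLuo2022ConvexIntegration`);
* `eLqLpNorm_two_wp_le` — conclusion:
  `‖w^{(p)}‖_{L²(0,T;L²)} ≤ (c₁‖R‖_{L¹_{t,x}} + c₂γ₀T + 5N[ν⁻¹(2A² + TA) + σ⁻²ACμ^a(T+1)])^{1/2}`.

## References

* A. Cheskidov, X. Luo, arXiv:2009.06596, §4.4 Lemma 4.4, §5.2 Lemma 5.2, Prop. 5.3 with
  (5.7)–(5.8), §7.1 Lemma 7.1. [`CheskidovLuo2022`]
-/

noncomputable section

open Set Filter Topology Function MeasureTheory Finset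
open scoped ContDiff ENNReal

namespace Literature.Analysis.FluidPDE

namespace CL22

open FunctionSpaces NashGeometric Mikado Intermittent

variable {d : Type*} [Fintype d] [DecidableEq d]

namespace Datum

variable {D : Datum d} (h : D.Valid) {A C : ℝ} (hA : D.DataBounds A) (hC : D.BlockConsts C)

/-! ## One direction at a time: the exact pointwise energy density -/

include h in
/-- **`‖w^{(p)}(t,y)‖² = ∑_x (G_x ã_x ψ_x(σ·))² |k_x|²`**: at most one `G_x(t)` is non-zero.
[cite: CheskidovLuo2022, Prop. 5.3] -/
theorem norm_wp_sq (t : ℝ) (y : UnitAddTorus d) :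
    ‖D.wp t y‖ ^ 2 = ∑ x, (D.G x t * D.atil x t y * D.Ψ x y) ^ 2 * dirNormSq x := by
  have hk : ∀ (x : Index d) (c : ℝ), ‖c • dirVec x‖ ^ 2 = c ^ 2 * dirNormSq x := by
    intro x c
    rw [norm_smul, mul_pow, Real.norm_eq_abs, sq_abs]
    congr 1
    rw [EuclideanSpace.norm_sq_eq, ← sum_sq_dir x]
    exact Finset.sum_congr rfl fun l _ => by simp [dirVec, sq_abs]
  unfold Datum.wp
  by_cases hex : ∃ x₀, D.G x₀ t ≠ 0
  · obtain ⟨x₀, hx₀⟩ := hex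
    have hz : ∀ x, x ≠ x₀ → D.G x t = 0 := fun x hx =>
      (mul_eq_zero.1 (G_mul_G h hx t)).resolve_right hx₀
    rw [Finset.sum_eq_single x₀ (fun x _ hx => by rw [hz x hx]; simp) (fun h' => (h' (Finset.mem_univ _)).elim),
      Finset.sum_eq_single x₀ (fun x _ hx => by rw [hz x hx]; simp) (fun h' => (h' (Finset.mem_univ _)).elim)]
    exact hk x₀ _
  · push Not at hex
    simp [hex]

/-! ## The space integral -/

include h in
/-- `∫ ‖w^{(p)}(t)‖² = ∑_x G_x(t)²|k_x|² ∫ (ã_x ψ_x(σ·))²` on `[0,T]`. [cite: CheskidovLuo2022, Prop. 5.3] -/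
theorem integral_norm_wp_sq {t : ℝ} (ht : t ∈ Icc 0 D.T) :
    ∫ y, ‖D.wp t y‖ ^ 2 = ∑ x, D.G x t ^ 2 * dirNormSq x * ∫ y, (D.atil x t y * D.Ψ x y) ^ 2 := by
  simp_rw [norm_wp_sq h t]
  have hi : ∀ x, Integrable (fun y => (D.G x t * D.atil x t y * D.Ψ x y) ^ 2 * dirNormSq x) volume := fun x =>
    ((((continuous_const.mul (isSmooth_atil h x ht).continuous).mul (isSmooth_Ψ h x).continuous).pow 2).mul
      continuous_const).integrable_unitAddTorus
  rw [integral_finsetSum _ fun x _ => hi x]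
  refine Finset.sum_congr rfl fun x _ => ?_
  rw [← integral_const_mul]
  exact integral_congr_ae (Eventually.of_forall fun y => by ring)

include h hA hC in
/-- **The decorrelation in space** (Green pairing, the `p = 2` substitute for Lemma 7.1):
`|∫ ã_x(t)² (ψ_x² - 1)(σ·)| ≤ σ⁻² A C μ^a`. [cite: CheskidovLuo2022, §7.1 Lemma 7.1] -/
theorem abs_integral_atilSq_fluct_le {t : ℝ} (ht : t ∈ Icc 0 D.T) (x : Index d) :
    |∫ y, D.atil x t y ^ 2 * fluct x D.μ (D.σ • y)| ≤ ((D.σ : ℝ) ^ 2)⁻¹ * A * (C * D.μ ^ aexp d) := by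
  have hb : Torus.IsSmooth (fun z => D.atil x t z ^ 2) := (smooth_atilSq h x).isSmooth_slice ht
  have h1 := abs_integral_mul_comp_nsmul_le h.hd hb (isSmooth_fluct x h.hμ) (integral_fluct h.hd x h.hμ) h.hσ
    (hA.lap_atilSq_le x t ht)
  refine h1.trans ?_
  exact mul_le_mul_of_nonneg_left (hC.invLap_fluct_L2 x) (mul_nonneg (by positivity) hA.nonneg)

include h hA hC in
/-- **`∫ (ã_x ψ_x(σ·))² ≤ ∫ ã_x² + σ⁻² A C μ^a`** (`∫ψ_x² = 1` plus decorrelation). [cite: CheskidovLuo2022, Prop. 5.3 (5.7)] -/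
theorem integral_atil_mul_Psi_sq_le {t : ℝ} (ht : t ∈ Icc 0 D.T) (x : Index d) :
    ∫ y, (D.atil x t y * D.Ψ x y) ^ 2 ≤ (∫ y, D.atil x t y ^ 2) + ((D.σ : ℝ) ^ 2)⁻¹ * A * (C * D.μ ^ aexp d) := by
  have ha := (isSmooth_atil h x ht).continuous
  have hΨ := (isSmooth_Ψ h x).continuous
  have hfl : Continuous fun y => fluct x D.μ (D.σ • y) := (isSmooth_comp_nsmul (isSmooth_fluct x h.hμ) D.σ).continuous
  have e : ∀ y, (D.atil x t y * D.Ψ x y) ^ 2 = D.atil x t y ^ 2 + D.atil x t y ^ 2 * fluct x D.μ (D.σ • y) := by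
    intro y
    have : D.Ψ x y ^ 2 = fluct x D.μ (D.σ • y) + 1 := by simp [Datum.Ψ, psiR, fluct]
    rw [mul_pow, this]; ring
  simp_rw [e]
  have hi1 : Integrable (fun y => D.atil x t y ^ 2) volume := (ha.pow 2).integrable_unitAddTorus
  have hi2 : Integrable (fun y => D.atil x t y ^ 2 * fluct x D.μ (D.σ • y)) volume := ((ha.pow 2).mul hfl).integrable_unitAddTorus
  rw [integral_add hi1 hi2]
  have := abs_integral_atilSq_fluct_le h hA hC ht x
  linarith [le_abs_self (∫ y, D.atil x t y ^ 2 * fluct x D.μ (D.σ • y))]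

include h hA hC in
/-- **`∫ ‖w^{(p)}(t)‖² ≤ ∑_x G_x(t)² |k_x|² (∫ ã_x(t)² + σ⁻²ACμ^a)`** on `[0,T]`. [cite: CheskidovLuo2022, Prop. 5.3 (5.7)] -/
theorem integral_norm_wp_sq_le {t : ℝ} (ht : t ∈ Icc 0 D.T) :
    ∫ y, ‖D.wp t y‖ ^ 2 ≤
      ∑ x, D.G x t ^ 2 * dirNormSq x * ((∫ y, D.atil x t y ^ 2) + ((D.σ : ℝ) ^ 2)⁻¹ * A * (C * D.μ ^ aexp d)) := by
  rw [integral_norm_wp_sq h ht]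
  exact Finset.sum_le_sum fun x _ => mul_le_mul_of_nonneg_left (integral_atil_mul_Psi_sq_le h hA hC ht x)
    (mul_nonneg (sq_nonneg _) (dirNormSq_pos x).le)

/-! ## The time integral: (5.8) -/

include h hA in
/-- `|∫ ã_x(t)²| ≤ A²` and the integrand is continuous in `t`. [folklore] -/
theorem abs_integral_atilSq_le {t : ℝ} (ht : t ∈ Icc 0 D.T) (x : Index d) : |∫ y, D.atil x t y ^ 2| ≤ A ^ 2 := by
  rw [abs_of_nonneg (integral_nonneg fun _ => sq_nonneg _)]
  have h1 : ∀ y, D.atil x t y ^ 2 ≤ A ^ 2 := fun y => by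
    have := hA.atil_le x t ht y
    rw [← sq_abs]; exact pow_le_pow_left₀ (abs_nonneg _) this 2
  calc ∫ y, D.atil x t y ^ 2 ≤ ∫ _y : UnitAddTorus d, A ^ 2 :=
        integral_mono (((isSmooth_atil h x ht).continuous.pow 2).integrable_unitAddTorus) (integrable_const _) h1
    _ = A ^ 2 := by simp

include h hA in
/-- **(5.8): `∫₀ᵀ G_x² (∫ã_x²) ≤ ∫₀ᵀ∫ã_x² + ν⁻¹(2A² + TA)`** (integration by parts against
`g_κ²(νt) - 1`; `t ↦ ∫ã_x(t)²` is `C¹` on `[0,T]` with derivative `∫∂ₜ(ã_x²)`, bounded by `A`).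
[cite: CheskidovLuo2022, Prop. 5.3 (5.8)] -/
theorem intervalIntegral_G_sq_mul_le (x : Index d) :
    ∫ t in (0 : ℝ)..D.T, D.G x t ^ 2 * ∫ y, D.atil x t y ^ 2 ≤
      (∫ t in (0 : ℝ)..D.T, ∫ y, D.atil x t y ^ 2) + D.ν⁻¹ * (2 * A ^ 2 + D.T * A) := by
  have hT := h.hT.le
  have hsm := smooth_atilSq h x
  set F : ℝ → ℝ := fun t => ∫ y, D.atil x t y ^ 2 with hF
  set F' : ℝ → ℝ := fun t => ∫ y, Torus.timeDerivWithin (Icc 0 D.T) (fun s z => D.atil x s z ^ 2) t y with hF'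
  have hder : ∀ t ∈ Icc 0 D.T, HasDerivWithinAt F (F' t) (Icc 0 D.T) t := fun t ht =>
    hsm.hasDerivWithinAt_integral (convex_Icc 0 D.T) ht
  have hF'c : ContinuousOn F' (Icc 0 D.T) :=
    (hsm.timeDerivWithin (uniqueDiffOn h)).continuousOn_integral (convex_Icc 0 D.T)
  have hFc : ContinuousOn F (Icc 0 D.T) := hsm.continuousOn_integral (convex_Icc 0 D.T)
  have hF'b : ∀ t ∈ Icc 0 D.T, |F' t| ≤ A := by
    intro t ht
    calc |F' t| ≤ ∫ y, |Torus.timeDerivWithin (Icc 0 D.T) (fun s z => D.atil x s z ^ 2) t y| := by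
          rw [hF']; exact abs_integral_le_integral_abs
      _ ≤ ∫ _y : UnitAddTorus d, A := integral_mono
          (((hsm.timeDerivWithin (uniqueDiffOn h)).isSmooth_slice ht).continuous.abs.integrable_unitAddTorus)
          (integrable_const _) fun y => hA.dt_atilSq_le x t ht y
      _ = A := by simp
  -- split `G² F = F + (G² - 1) F`
  have hGc : Continuous (D.G x) := (contDiff_G h x).continuous
  have hi1 : IntervalIntegrable F volume 0 D.T := (hFc.mono (by rw [uIcc_of_le hT])).intervalIntegrable
  have hi2 : IntervalIntegrable (fun t => (D.G x t ^ 2 - 1) * F t) volume 0 D.T :=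
    ((((hGc.pow 2).sub continuous_const).continuousOn).mul (hFc.mono (by rw [uIcc_of_le hT]))).intervalIntegrable
  have e : ∫ t in (0 : ℝ)..D.T, D.G x t ^ 2 * F t = (∫ t in (0 : ℝ)..D.T, F t) + ∫ t in (0 : ℝ)..D.T, (D.G x t ^ 2 - 1) * F t := by
    rw [← intervalIntegral.integral_add hi1 hi2]
    exact intervalIntegral.integral_congr fun t _ => by ring
  rw [e]
  have hparts := (h.hg x).abs_intervalIntegral_oscProfile_sq_sub_one_mul_le h.hκ h.hν (h.hg1 x) hT hder hF'c
  have hparts' : |∫ t in (0 : ℝ)..D.T, (D.G x t ^ 2 - 1) * F t| ≤ D.ν⁻¹ * (|F 0| + |F D.T| + ∫ t in (0 : ℝ)..D.T, |F' t|) := by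
    simpa [Datum.G] using hparts
  have hb0 := abs_integral_atilSq_le h hA (left_mem_Icc.2 hT) x
  have hbT := abs_integral_atilSq_le h hA (right_mem_Icc.2 hT) x
  have hint : ∫ t in (0 : ℝ)..D.T, |F' t| ≤ D.T * A := by
    calc ∫ t in (0 : ℝ)..D.T, |F' t| ≤ ∫ _t in (0 : ℝ)..D.T, A :=
          intervalIntegral.integral_mono_on hT ((hF'c.abs).mono (by rw [uIcc_of_le hT]) |>.intervalIntegrable)
            intervalIntegrable_const fun t ht => hF'b t ht
      _ = D.T * A := by simp [mul_comm]
  have hν0 : 0 ≤ D.ν⁻¹ := inv_nonneg.2 (by linarith [h.hν])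
  have key : ∫ t in (0 : ℝ)..D.T, (D.G x t ^ 2 - 1) * F t ≤ D.ν⁻¹ * (2 * A ^ 2 + D.T * A) := by
    refine (le_abs_self _).trans (hparts'.trans ?_)
    refine mul_le_mul_of_nonneg_left ?_ hν0
    linarith
  linarith

/-! ## The trace identity of Lemma 4.4 with the floor -/

include h in
/-- **`∑_x |k_x|² ã_x(t,y)² ≤ c₁ ‖R(t,y)‖ + c₂ γ₀`** on `[0,T]`, `c₁ = 2d²/r_d + d`, `c₂ = 2d/r_d`
(`∑_x â_x²(k_x)ᵢ(k_x)ᵢ = ρ - Rᵢᵢ` summed over `i`, `θ² ≤ 1`, `ρ ≤ (2/r_d)(d‖R‖ + γ₀)`).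
[cite: CheskidovLuo2022, §4.4 Lemma 4.4] -/
theorem sum_dirNormSq_mul_atil_sq_le {t : ℝ} (ht : t ∈ Icc 0 D.T) (y : UnitAddTorus d) :
    ∑ x, dirNormSq x * D.atil x t y ^ 2 ≤
      (2 * (Fintype.card d : ℝ) ^ 2 / radius d + Fintype.card d) * ‖D.R t y‖ + (2 * Fintype.card d / radius d) * D.γ₀ := by
  have hd := h.hd
  have hγ := h.hγ
  have hθ := h.hθ01 t
  have hθ2 : D.θ t ^ 2 ≤ 1 := by nlinarith [hθ.1, hθ.2]
  -- `∑_x |k_x|² â_x² = ∑ᵢ (ρ - Rᵢᵢ)`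
  have hid : ∑ x, dirNormSq x * D.ahat x t y ^ 2 = ∑ i, (divisor D.γ₀ D.R t y - D.R t y i i) := by
    have e1 : ∀ x, dirNormSq x * D.ahat x t y ^ 2 = ∑ i, amp D.γ₀ D.R x t y ^ 2 * (((dir x i : ℤ) : ℝ) * ((dir x i : ℤ) : ℝ)) := by
      intro x
      rw [← sum_sq_dir x, Finset.sum_mul]
      exact Finset.sum_congr rfl fun i _ => by rw [Datum.ahat]; ring
    simp_rw [e1]
    rw [Finset.sum_comm]
    refine Finset.sum_congr rfl fun i _ => ?_
    rw [sum_amp_sq_mul_dir hd hγ (h.hRsym t ht y) i i]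
    simp
  have hρ := divisor_le_norm (R := D.R) hd hγ t y
  have hdiag : ∀ i, |D.R t y i i| ≤ ‖D.R t y‖ := fun i =>
    (Torus.abs_apply_le_norm (D.R t y i) i).trans (norm_le_pi_norm (D.R t y) i)
  have hr := radius_pos hd
  have hsum : ∑ x, dirNormSq x * D.ahat x t y ^ 2 ≤
      (2 * (Fintype.card d : ℝ) ^ 2 / radius d + Fintype.card d) * ‖D.R t y‖ + (2 * Fintype.card d / radius d) * D.γ₀ := by
    rw [hid]
    calc ∑ i, (divisor D.γ₀ D.R t y - D.R t y i i)
        ≤ ∑ _i : d, ((2 / radius d) * (Fintype.card d * ‖D.R t y‖ + D.γ₀) + ‖D.R t y‖) :=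
          Finset.sum_le_sum fun i _ => by linarith [hdiag i, neg_abs_le (D.R t y i i)]
      _ = (2 * (Fintype.card d : ℝ) ^ 2 / radius d + Fintype.card d) * ‖D.R t y‖ + (2 * Fintype.card d / radius d) * D.γ₀ := by
          rw [Finset.sum_const, Finset.card_univ, nsmul_eq_mul]
          field_simp
          ring
  have hnn : 0 ≤ ∑ x, dirNormSq x * D.ahat x t y ^ 2 :=
    Finset.sum_nonneg fun x _ => mul_nonneg (dirNormSq_pos x).le (sq_nonneg _)
  calc ∑ x, dirNormSq x * D.atil x t y ^ 2 = D.θ t ^ 2 * ∑ x, dirNormSq x * D.ahat x t y ^ 2 := by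
        rw [Finset.mul_sum]
        exact Finset.sum_congr rfl fun x _ => by rw [Datum.atil]; ring
    _ ≤ 1 * ∑ x, dirNormSq x * D.ahat x t y ^ 2 := mul_le_mul_of_nonneg_right hθ2 hnn
    _ ≤ _ := by rw [one_mul]; exact hsum

omit [DecidableEq d] in
/-- `t ↦ ∫ ‖R(t,y)‖ dy` is continuous on `[0,T]` for a jointly smooth field. [folklore] -/
theorem continuousOn_integral_norm {F : Type*} [NormedAddCommGroup F] [NormedSpace ℝ F]
    {R : ℝ → UnitAddTorus d → F} {T : ℝ} (hR : Torus.IsSmoothSpaceTimeOn (Icc 0 T) R) :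
    ContinuousOn (fun t => ∫ y, ‖R t y‖) (Icc 0 T) := by
  have hsl : ∀ t ∈ Icc 0 T, (eLpNorm (R t) 1 volume).toReal = ∫ y, ‖R t y‖ := by
    intro t ht
    rw [eLpNorm_one_eq_lintegral_enorm, integral_norm_eq_lintegral_enorm (hR.isSmooth_slice ht).continuous.aestronglyMeasurable]
  exact (hR.continuousOn_eLpNorm_toReal le_rfl).congr fun t ht => (hsl t ht).symm

include h in
/-- **`∑_x |k_x|² ∫₀ᵀ∫ ã_x² ≤ c₁ ∫₀ᵀ∫‖R‖ + c₂ γ₀ T`**. [cite: CheskidovLuo2022, Prop. 5.3] -/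
theorem sum_dirNormSq_mul_intervalIntegral_le :
    ∑ x, dirNormSq x * ∫ t in (0 : ℝ)..D.T, ∫ y, D.atil x t y ^ 2 ≤
      (2 * (Fintype.card d : ℝ) ^ 2 / radius d + Fintype.card d) * (∫ t in (0 : ℝ)..D.T, ∫ y, ‖D.R t y‖) +
        (2 * Fintype.card d / radius d) * D.γ₀ * D.T := by
  have hT := h.hT.le
  set c₁ : ℝ := 2 * (Fintype.card d : ℝ) ^ 2 / radius d + Fintype.card d with hc₁
  set c₂ : ℝ := 2 * Fintype.card d / radius d with hc₂
  have hFc : ∀ x, ContinuousOn (fun t => ∫ y, D.atil x t y ^ 2) (Icc 0 D.T) := fun x =>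
    (smooth_atilSq h x).continuousOn_integral (convex_Icc 0 D.T)
  have hRc : ContinuousOn (fun t => ∫ y, ‖D.R t y‖) (Icc 0 D.T) := continuousOn_integral_norm h.hR
  have hint : ∀ x, IntervalIntegrable (fun t => ∫ y, D.atil x t y ^ 2) volume 0 D.T := fun x =>
    ((hFc x).mono (by rw [uIcc_of_le hT])).intervalIntegrable
  -- move the finite sum inside both integrals
  have e1 : ∑ x, dirNormSq x * ∫ t in (0 : ℝ)..D.T, ∫ y, D.atil x t y ^ 2 =
      ∫ t in (0 : ℝ)..D.T, ∑ x, dirNormSq x * ∫ y, D.atil x t y ^ 2 := by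
    rw [intervalIntegral.integral_finsetSum fun x _ => (hint x).const_mul _]
    exact Finset.sum_congr rfl fun x _ => (intervalIntegral.integral_const_mul _ _).symm
  rw [e1]
  -- pointwise in time
  have hpt : ∀ t ∈ Icc 0 D.T, ∑ x, dirNormSq x * ∫ y, D.atil x t y ^ 2 ≤ c₁ * (∫ y, ‖D.R t y‖) + c₂ * D.γ₀ := by
    intro t ht
    have hi : ∀ x, Integrable (fun y => dirNormSq x * D.atil x t y ^ 2) volume := fun x =>
      (continuous_const.mul ((isSmooth_atil h x ht).continuous.pow 2)).integrable_unitAddTorus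
    have e2 : ∑ x, dirNormSq x * ∫ y, D.atil x t y ^ 2 = ∫ y, ∑ x, dirNormSq x * D.atil x t y ^ 2 := by
      rw [integral_finsetSum _ fun x _ => hi x]
      exact Finset.sum_congr rfl fun x _ => (integral_const_mul _ _).symm
    rw [e2]
    have hR1 : Integrable (fun y => c₁ * ‖D.R t y‖) volume :=
      ((h.hR.isSmooth_slice ht).continuous.norm.const_mul c₁).integrable_unitAddTorus
    have hRi : Integrable (fun y => c₁ * ‖D.R t y‖ + c₂ * D.γ₀) volume := hR1.add (integrable_const _)
    have hSi : Integrable (fun y => ∑ x, dirNormSq x * D.atil x t y ^ 2) volume := integrable_finsetSum _ fun x _ => hi x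
    calc ∫ y, ∑ x, dirNormSq x * D.atil x t y ^ 2 ≤ ∫ y, (c₁ * ‖D.R t y‖ + c₂ * D.γ₀) :=
          integral_mono hSi hRi fun y => sum_dirNormSq_mul_atil_sq_le h ht y
      _ = c₁ * (∫ y, ‖D.R t y‖) + c₂ * D.γ₀ := by
          rw [integral_add hR1 (integrable_const _), integral_const_mul, integral_const]
          simp
  have hsc : ContinuousOn (fun t => ∑ x, dirNormSq x * ∫ y, D.atil x t y ^ 2) (Icc 0 D.T) :=
    continuousOn_finsetSum _ fun x _ => continuousOn_const.mul (hFc x)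
  have hI1 : IntervalIntegrable (fun t => c₁ * ∫ y, ‖D.R t y‖) volume 0 D.T :=
    ((continuousOn_const.mul hRc).mono (by rw [uIcc_of_le hT])).intervalIntegrable
  have hI2 : IntervalIntegrable (fun t => c₁ * (∫ y, ‖D.R t y‖) + c₂ * D.γ₀) volume 0 D.T := hI1.add intervalIntegrable_const
  have hI3 : IntervalIntegrable (fun t => ∑ x, dirNormSq x * ∫ y, D.atil x t y ^ 2) volume 0 D.T :=
    (hsc.mono (by rw [uIcc_of_le hT])).intervalIntegrable
  calc ∫ t in (0 : ℝ)..D.T, ∑ x, dirNormSq x * ∫ y, D.atil x t y ^ 2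
      ≤ ∫ t in (0 : ℝ)..D.T, (c₁ * (∫ y, ‖D.R t y‖) + c₂ * D.γ₀) := intervalIntegral.integral_mono_on hT hI3 hI2 hpt
    _ = c₁ * (∫ t in (0 : ℝ)..D.T, ∫ y, ‖D.R t y‖) + c₂ * D.γ₀ * D.T := by
        rw [intervalIntegral.integral_add hI1 intervalIntegrable_const, intervalIntegral.integral_const_mul,
          intervalIntegral.integral_const]
        simp; ring

/-! ## The energy estimate -/

include h hA hC in
/-- **The energy estimate for the principal part (CL22 Prop. 5.3, `L²_{t,x}`):**
`‖w^{(p)}‖_{L²(0,T;L²(𝕋^d))} ≤ (c₁‖R‖_{L¹_{t,x}} + c₂γ₀T + 5N[ν⁻¹(2A² + TA) + σ⁻²ACμ^a(T+1)])^{1/2}`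
with `c₁ = 2d²/r_d + d`, `c₂ = 2d/r_d`, `N = #Λ`, `‖R‖_{L¹_{t,x}} = ∫₀ᵀ∫‖R‖`. The printed
`‖w^{(p)}‖₂ ≲ ‖R̄‖₁^{1/2} + C_uσ^{-1/2}` is this bound with the floor term `γ₀T` made `≲ ‖R̄‖₁` and
`λ` large. [cite: CheskidovLuo2022, Prop. 5.3] -/
theorem eLqLpNorm_two_wp_le :
    eLqLpNorm 2 2 D.wp (Ioo 0 D.T) ≤ ENNReal.ofReal (Real.sqrt
      ((2 * (Fintype.card d : ℝ) ^ 2 / radius d + Fintype.card d) * (∫ t in (0 : ℝ)..D.T, ∫ y, ‖D.R t y‖) +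
        (2 * Fintype.card d / radius d) * D.γ₀ * D.T +
        5 * Fintype.card (Index d) *
          (D.ν⁻¹ * (2 * A ^ 2 + D.T * A) + ((D.σ : ℝ) ^ 2)⁻¹ * A * (C * D.μ ^ aexp d) * (D.T + 1)))) := by
  have hT := h.hT.le
  set E₀ : ℝ := ((D.σ : ℝ) ^ 2)⁻¹ * A * (C * D.μ ^ aexp d) with hE₀
  have hE₀0 : 0 ≤ E₀ := by
    have := hA.nonneg; have := hC.nonneg; have : 0 ≤ D.μ := by linarith [h.hμ]
    positivity
  set e : ℝ → ℝ := fun t => ∑ x, D.G x t ^ 2 * dirNormSq x * ((∫ y, D.atil x t y ^ 2) + E₀) with he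
  have hFc : ∀ x, ContinuousOn (fun t => ∫ y, D.atil x t y ^ 2) (Icc 0 D.T) := fun x =>
    (smooth_atilSq h x).continuousOn_integral (convex_Icc 0 D.T)
  have hGc : ∀ x, Continuous (D.G x) := fun x => (contDiff_G h x).continuous
  have hec : ContinuousOn e (Icc 0 D.T) :=
    continuousOn_finsetSum _ fun x _ => ((((hGc x).pow 2).mul continuous_const).continuousOn).mul
      ((hFc x).add continuousOn_const)
  have he0 : ∀ t ∈ Icc 0 D.T, 0 ≤ e t := fun t _ => Finset.sum_nonneg fun x _ =>
    mul_nonneg (mul_nonneg (sq_nonneg _) (dirNormSq_pos x).le) (add_nonneg (integral_nonneg fun _ => sq_nonneg _) hE₀0)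
  have hslice : ∀ t ∈ Ioo 0 D.T, ∫ y, ‖D.wp t y‖ ^ 2 ≤ e t := fun t ht =>
    integral_norm_wp_sq_le h hA hC (Ioo_subset_Icc_self ht)
  -- the time integral of `e`
  have hint : ∀ x, IntervalIntegrable (fun t => ∫ y, D.atil x t y ^ 2) volume 0 D.T := fun x =>
    ((hFc x).mono (by rw [uIcc_of_le hT])).intervalIntegrable
  have hGi : ∀ x, IntervalIntegrable (fun t => D.G x t ^ 2) volume 0 D.T := fun x => ((hGc x).pow 2).intervalIntegrable _ _
  have hterm : ∀ x, ∫ t in (0 : ℝ)..D.T, D.G x t ^ 2 * dirNormSq x * ((∫ y, D.atil x t y ^ 2) + E₀) ≤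
      dirNormSq x * ((∫ t in (0 : ℝ)..D.T, ∫ y, D.atil x t y ^ 2) + D.ν⁻¹ * (2 * A ^ 2 + D.T * A) + E₀ * (D.T + 1)) := by
    intro x
    have hk0 := (dirNormSq_pos x).le
    have h1 := intervalIntegral_G_sq_mul_le h hA x
    have h2 := intervalIntegral_G_sq_le h x
    have hiGF : IntervalIntegrable (fun t => D.G x t ^ 2 * ∫ y, D.atil x t y ^ 2) volume 0 D.T :=
      (((hGc x).pow 2).continuousOn.mul ((hFc x).mono (by rw [uIcc_of_le hT]))).intervalIntegrable
    have e1 : ∫ t in (0 : ℝ)..D.T, D.G x t ^ 2 * dirNormSq x * ((∫ y, D.atil x t y ^ 2) + E₀) =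
        dirNormSq x * ((∫ t in (0 : ℝ)..D.T, D.G x t ^ 2 * ∫ y, D.atil x t y ^ 2) + E₀ * ∫ t in (0 : ℝ)..D.T, D.G x t ^ 2) := by
      rw [← intervalIntegral.integral_const_mul E₀, ← intervalIntegral.integral_add hiGF ((hGi x).const_mul E₀),
        ← intervalIntegral.integral_const_mul]
      exact intervalIntegral.integral_congr fun t _ => by ring
    rw [e1]
    refine mul_le_mul_of_nonneg_left ?_ hk0
    have h3 : E₀ * ∫ t in (0 : ℝ)..D.T, D.G x t ^ 2 ≤ E₀ * (D.T + 1) := mul_le_mul_of_nonneg_left h2 hE₀0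
    linarith
  have hsumle : ∫ t in (0 : ℝ)..D.T, e t ≤
      (2 * (Fintype.card d : ℝ) ^ 2 / radius d + Fintype.card d) * (∫ t in (0 : ℝ)..D.T, ∫ y, ‖D.R t y‖) +
        (2 * Fintype.card d / radius d) * D.γ₀ * D.T +
        5 * Fintype.card (Index d) * (D.ν⁻¹ * (2 * A ^ 2 + D.T * A) + E₀ * (D.T + 1)) := by
    have hie : ∀ x, IntervalIntegrable (fun t => D.G x t ^ 2 * dirNormSq x * ((∫ y, D.atil x t y ^ 2) + E₀)) volume 0 D.T :=
      fun x => ((((hGc x).pow 2).mul continuous_const).continuousOn.mul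
        (((hFc x).add continuousOn_const).mono (by rw [uIcc_of_le hT]))).intervalIntegrable
    rw [he, intervalIntegral.integral_finsetSum fun x _ => hie x]
    have hmain := sum_dirNormSq_mul_intervalIntegral_le h
    have hrest : ∑ x : Index d, dirNormSq x * (D.ν⁻¹ * (2 * A ^ 2 + D.T * A) + E₀ * (D.T + 1)) ≤
        5 * Fintype.card (Index d) * (D.ν⁻¹ * (2 * A ^ 2 + D.T * A) + E₀ * (D.T + 1)) := by
      have hq : 0 ≤ D.ν⁻¹ * (2 * A ^ 2 + D.T * A) + E₀ * (D.T + 1) := by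
        have := hA.nonneg; have : 0 ≤ D.ν⁻¹ := inv_nonneg.2 (by linarith [h.hν]); positivity
      calc ∑ x : Index d, dirNormSq x * (D.ν⁻¹ * (2 * A ^ 2 + D.T * A) + E₀ * (D.T + 1))
          ≤ ∑ _x : Index d, 5 * (D.ν⁻¹ * (2 * A ^ 2 + D.T * A) + E₀ * (D.T + 1)) :=
            Finset.sum_le_sum fun x _ => mul_le_mul_of_nonneg_right (dirNormSq_le x) hq
        _ = _ := by rw [Finset.sum_const, Finset.card_univ, nsmul_eq_mul]; ring
    calc ∑ x, ∫ t in (0 : ℝ)..D.T, D.G x t ^ 2 * dirNormSq x * ((∫ y, D.atil x t y ^ 2) + E₀)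
        ≤ ∑ x, dirNormSq x * ((∫ t in (0 : ℝ)..D.T, ∫ y, D.atil x t y ^ 2) + D.ν⁻¹ * (2 * A ^ 2 + D.T * A) + E₀ * (D.T + 1)) :=
          Finset.sum_le_sum fun x _ => hterm x
      _ = (∑ x, dirNormSq x * ∫ t in (0 : ℝ)..D.T, ∫ y, D.atil x t y ^ 2) +
            ∑ x : Index d, dirNormSq x * (D.ν⁻¹ * (2 * A ^ 2 + D.T * A) + E₀ * (D.T + 1)) := by
          rw [← Finset.sum_add_distrib]; exact Finset.sum_congr rfl fun x _ => by ring
      _ ≤ _ := by linarith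
  exact Torus.eLqLpNorm_two_two_le_of_integral_sq_le hT (fun t ht => ((smooth_wp h).isSmooth_slice (Ioo_subset_Icc_self ht)).continuous)
    hec he0 hslice hsumle

end Datum

end CL22

end Literature.Analysis.FluidPDE
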